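import Summits.BirchSwinnertonDyer.BirchSwinnertonDyer.Theses.ByReductionTypeAtTwo
import Summits.BirchSwinnertonDyer.BirchSwinnertonDyer.Theorems.ByReductionTypeAtTwoTowerLevelOneLayer
import Summits.BirchSwinnertonDyer.BirchSwinnertonDyer.Theorems.ByReductionTypeAtTwoGVISeed
import Summits.BirchSwinnertonDyer.BirchSwinnertonDyer.Theorems.ByReductionTypeAtTwoCarrierWitness
import Summits.BirchSwinnertonDyer.Rank1Residual.X5.KatoOrdTwoMuPart
import Literature.NumberTheory.EllipticCurves.KatoRankBoundProofs
import HarnessLib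

/-!
# A one-sided DATA TEST of the crux `OrdKatoHalfAtTwo`: an EXCESS of `2`-torsion Selmer classes at any
# layer of the cyclotomic `ℤ₂`-tower over one rank-`0` good-ordinary curve with `μ_an = 0` refutes it
# (route ByReductionTypeAtTwo, item stmt-BirchSwinnertonDyer-19271; seat bsd-2adic-ord-2, GEN 2)

HONEST FRAMING (cell `bsd-2adic`, run/shared/lean/pub/bsd-2adic/, HUMAN RULINGS D-0036/D-0074): THEOREMS
ONLY; nothing asserted; no definition; no new named fact; closes nothing; NO WITNESS IS KNOWN OR
CLAIMED — the `2`-adic main conjecture predicts that none exists. This file turns the seat's MEMO-2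
§2(d) reading («`e₀ ≤ λ_an` is a necessary condition») into a kernel-checked refutation SCHEMA, so that
the engineer's layer tables (seat bsd-2adic-tower-eng, `d_j = dim Sel₂(E/ℚ_j)`) double as an
adversarial test of the crux, and the crux's disprover has a typed target.

## The mechanism (§1, per curve)

Let `W/ℚ` be globally minimal, good ordinary at `2`, with ODD torsion order, `f` its newform and `ϖ`
the Néron index (`ϖ·Ω_W = Ω⁺_f`, supplied by modularity `hmod`). Suppose the Kato–Néron half holds AT
`W` (`X5.O1.MainConjectureLowerDivisibilityAtTwoOrd W`: `ϖ·L₂(f,α) = ι g`, `g ∈ char_Λ X` for every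
cyclotomic datum). Then for every cyclotomic datum:
* `μ(X) = 0`: the half gives `2^{μ(X)} ∣ g` (tree `katoMuPartAtTwo_of_mainConjectureLowerDivisibilityAtTwoOrd`,
  Kato 17.4 (1)@2 for torsion), so every coefficient of `ϖ·L₂` has norm `≤ 2^{-μ(X)}`
  (`norm_coeff_map_le_of_C_pow_dvd`); the certificate `μ_an = 0` (`AnalyticMuLE W 2 0`: one
  coefficient of norm `> 1/2`) forces `μ(X) = 0`;
* `λ(X) ≤ n`: Kato 17.4 (1)(2)@2 gives `λ(X) ≤ λ(g)` (tree `GVISeed.isTorsion_and_lambda_le_lam_of_kato`)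
  and the certificate `λ_an = n` (`AnalyticLambdaEq W 2 n`) gives `λ(g) = n`;
* no finite submodule (PUBLISHED Greenberg Prop. 4.14@2, odd torsion), hence
  `#X/(2,T^j)X ≤ #X/2X = 2^{λ(X)} ≤ 2^n` for EVERY `j`
  (`natCard_quotient_towerIdeal_le_pow_of_katoHalfAt`, via p419840's
  `le_lambdaInvariant_of_pow_le_natCard_quotient_towerIdeal`).

## The test (§2)

Contrapositive over the ROUTE decl: ONE non-CM, analytic-rank-`0`, good-ordinary-at-`2` curve `W` with
odd torsion order, `μ_an = 0`, `λ_an = n`, and an EXCESS `2^{n+1} ≤ #X/(2,T^j)X` for some `j` on every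
cyclotomic datum (`not_ordKatoHalfAtTwo_of_towerExcess`) — in finite-layer currency
`2^{n+1} ≤ #Sel_{2^∞}(W/ℚ_i)[2]` for some layer `i` (`not_ordKatoHalfAtTwo_of_layerSelmerExcess`; with
`E(ℚ_i)[2] = 0` this is `dim_{𝔽₂} Sel₂(W/ℚ_i) ≥ λ_an + 1`, a classical `2`-descent) — gives
`¬ OrdKatoHalfAtTwo`, modulo the displayed PUBLISHED inputs {modularity `hmod`, Kato 17.4 (1)(2)@2 at
`W`, Greenberg 4.14@2}. READING for the engineer (nothing asserted): on the 440 open irreducible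
classes the `2`-adic IMC predicts `d_i ≤ dim A_i[2] = a_{2^i} ≤ λ_an` at every layer `i`; e.g. on the 80
classes with `λ_an = 2`, `dim Sel₂(E/ℚ(√2)) = 2` exactly is predicted (`≥ 2` by restriction from `ℚ`).
A table entry `d_i ≥ λ_an + 1` at a two-engine `μ_an = 0` member is a candidate refutation of the crux,
to be reported, not smoothed.

References: K. Kato, Astérisque 295 (2004), Thm. 17.4; R. Greenberg, LNM 1716 (1999), §1 p. 60, §3,
Prop. 4.14; R. Greenberg, V. Vatsal, Invent. Math. 142 (2000), p. 2 (1)–(2); L. Washington, GTM 83, §13.2.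
-/

set_option autoImplicit false

noncomputable section

open scoped Classical MatrixGroups ModularForm

open CongruenceSubgroup WeierstrassCurve Literature.NumberTheory.EllipticCurves
  Literature.NumberTheory.EllipticCurves.ModularForms Literature.NumberTheory.EllipticCurves.Rank1Residual
  Literature.NumberTheory.EllipticCurves.Rank1Residual.Typed
  Literature.NumberTheory.EllipticCurves.Greenberg1999
  Summit.BirchSwinnertonDyer.BirchSwinnertonDyer.Theorems.Rank1ResidualX1Defs
  Summit.BirchSwinnertonDyer.Rank1Residual.X1.MuLambda
  Summit.BirchSwinnertonDyer.Rank1Residual.X1.MuPart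
  Summit.BirchSwinnertonDyer.Rank1Residual.X1.MuStructure
  Summit.BirchSwinnertonDyer.Rank1Residual.X1.ParitySqueeze
  Summit.BirchSwinnertonDyer.Rank1Residual.Iwasawa
  Summit.BirchSwinnertonDyer.Rank1Residual.X5 Summit.BirchSwinnertonDyer.Rank1Residual.X5.O1
  Summit.BirchSwinnertonDyer.Rank1Residual.X5.TowerGap
  Summit.BirchSwinnertonDyer.Rank1Residual

namespace Summit.BirchSwinnertonDyer.BirchSwinnertonDyer.Theorems.KatoHalfPinch

/-! ## §1 Per curve: the Kato half at `W` + `μ_an = 0` + `λ_an = n` + 4.14 ⇒ `#X/(2,T^j)X ≤ 2^n` -/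

section Curve

variable (W : WeierstrassCurve ℚ) [W.IsElliptic] [W.IsGloballyMinimal]

/-- **`μ(X) = 0` and `λ(X) ≤ n` at `W` from the Kato–Néron half at `W`** (+ PRINT Kato 17.4 (1)(2)@2,
modularity for the newform/Néron index; certificates `μ_an = 0`, `λ_an = n`), for every cyclotomic
datum. [cite: Kato2004Asterisque, Thm. 17.4 (1)(2) (p. 273)] [cite: GreenbergVatsal2000, p. 2, (1)–(2)] -/
theorem mu_zero_and_lambda_le_of_katoHalfAt (hmod : nonempty_modularParametrizationData)
    (h17 : ∀ [NeZero (W.conductorNorm ℤ)] (f : CuspForm (Gamma0 (W.conductorNorm ℤ)) 2),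
      kato_divisibility_allPrimes W 2 (f := f))
    (hgo : GoodOrd W 2) (hK : MainConjectureLowerDivisibilityAtTwoOrd W) {n : ℕ}
    (hlan : AnalyticLambdaEq W 2 n) (hμan : AnalyticMuLE W 2 0)
    {κ : ZpExtension ℚ 2} {γ : Field.absoluteGaloisGroup ℚ} (hκ : κ.IsCyclotomic)
    (hγ : κ.IsTopGenerator γ) (hγ' : IsCyclotomicVariable 2 γ) (D : W.SelmerDualData κ γ) :
    D.IsTorsion ∧ D.mu = 0 ∧ D.lambda ≤ n := by
  have hord : IsOrdinaryAt W 2 := hgo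
  haveI : NeZero (W.conductorNorm ℤ) := ⟨(W.conductorNorm_pos_holds).ne'⟩
  haveI : Module.Finite (IwasawaAlgebra 2) D.X := D.module_finite_holds hγ
  obtain ⟨Dm⟩ := hmod W
  have hf : IsNewformOf W Dm.f := Dm.isNewformOf
  obtain ⟨ϖ, hϖpos, hϖeq, -⟩ := Dm.exists_rat_mul_realPeriodRat_eq_plusPeriod
  obtain ⟨g, -, hιg⟩ := hK κ γ hκ hγ hγ' hord Dm.f hf ϖ hϖeq D
  -- the `μ`-part: `2^{μ(X)} ∣ g`
  have hdvd : (PowerSeries.C (((2 : ℕ) : ℤ_[2]) ^ D.mu) : IwasawaAlgebra 2) ∣ g :=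
    katoMuPartAtTwo_of_mainConjectureLowerDivisibilityAtTwoOrd W h17 hK κ γ hκ hγ hγ' hord Dm.f hf ϖ
      hϖeq D g hιg
  have hdvd' : PowerSeries.C ((2 : ℕ) : ℤ_[2]) ^ D.mu ∣ g := by rwa [← map_pow]
  -- the analytic `μ = 0` certificate: a coefficient of `ι g = ϖ·L₂` of norm `> 1/2`
  obtain ⟨j, hj⟩ := hμan Dm.f hf ϖ hϖeq
  rw [← hιg] at hj
  have hle := norm_coeff_map_le_of_C_pow_dvd hdvd' j
  have hμ : D.mu = 0 := by
    have hlt : ((2 : ℕ) : ℝ) ^ (-((0 : ℤ) + 1)) < ((2 : ℕ) : ℝ) ^ (-(D.mu : ℤ)) := by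
      have hj' : ((2 : ℕ) : ℝ) ^ (-((0 : ℤ) + 1)) <
          ‖PowerSeries.coeff j (iwasawaToPowerSeries 2 g)‖ := by exact_mod_cast hj
      exact lt_of_lt_of_le hj' hle
    have h2 : (1 : ℝ) < ((2 : ℕ) : ℝ) := by norm_num
    have := (zpow_lt_zpow_iff_right₀ h2).mp hlt
    omega
  -- `g ≠ 0` (a coefficient has positive norm) and `ϖ ≠ 0`
  have hg0 : g ≠ 0 := by
    rintro rfl
    rw [map_zero, map_zero, norm_zero] at hj
    exact not_le.mpr hj (by positivity)
  have hϖ0 : ϖ ≠ 0 := ne_of_gt hϖpos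
  obtain ⟨hX, hlam⟩ :=
    GVISeed.isTorsion_and_lambda_le_lam_of_kato W (h17 Dm.f) hκ hγ hγ' hord hf D hϖ0 hιg hg0
  have hlamn : lam g = n := hlan Dm.f hf ϖ hϖeq g hιg
  exact ⟨hX, hμ, hlamn ▸ hlam⟩

/-- **Every layer quotient is bounded by `2^{λ_an}` once the Kato half holds at `W`**: with the
PUBLISHED Greenberg Prop. 4.14@2 (odd torsion order ⇒ no finite submodule), `#X/(2,T^j)X ≤ 2^n` for
every `j` and every cyclotomic datum. [cite: GreenbergLNM1716, Prop. 4.14 (§4)]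
[cite: Kato2004Asterisque, Thm. 17.4 (1)(2) (p. 273)] [cite: Washington1997, §13.2] -/
theorem natCard_quotient_towerIdeal_le_pow_of_katoHalfAt (hmod : nonempty_modularParametrizationData)
    (h17 : ∀ [NeZero (W.conductorNorm ℤ)] (f : CuspForm (Gamma0 (W.conductorNorm ℤ)) 2),
      kato_divisibility_allPrimes W 2 (f := f))
    (h414 : prop414_noFiniteSubmodule_of_not_dvd_torsionOrder) (htors : ¬ 2 ∣ W.torsionOrder)
    (hgo : GoodOrd W 2) (hK : MainConjectureLowerDivisibilityAtTwoOrd W) {n : ℕ}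
    (hlan : AnalyticLambdaEq W 2 n) (hμan : AnalyticMuLE W 2 0)
    {κ : ZpExtension ℚ 2} {γ : Field.absoluteGaloisGroup ℚ} (hκ : κ.IsCyclotomic)
    (hγ : κ.IsTopGenerator γ) (hγ' : IsCyclotomicVariable 2 γ) (D : W.SelmerDualData κ γ) (j : ℕ) :
    Nat.card (D.X ⧸ (towerIdeal 2 j • ⊤ : Submodule (IwasawaAlgebra 2) D.X)) < 2 ^ (n + 1) := by
  haveI : Module.Finite (IwasawaAlgebra 2) D.X := D.module_finite_holds hγ
  obtain ⟨hX, hμ, hlam⟩ := mu_zero_and_lambda_le_of_katoHalfAt W hmod h17 hgo hK hlan hμan hκ hγ hγ' D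
  by_contra hge
  push Not at hge
  have h := le_lambdaInvariant_of_pow_le_natCard_quotient_towerIdeal 2 hX hμ
    (fun N hN => h414 W 2 htors κ γ hκ hγ D hX N hN) hge
  have h' : n + 1 ≤ D.lambda := h
  omega

/-! ## §2 The test over the route decl -/

/-- **EXCESS TEST (module form).** ONE non-CM, analytic-rank-`0`, good-ordinary-at-`2` curve `W` with
odd torsion order, certificates `λ_an = n`, `μ_an = 0`, and an excess `2^{n+1} ≤ #X/(2,T^j)X` for some
`j` on every cyclotomic datum REFUTES the crux `OrdKatoHalfAtTwo`, modulo the displayed PUBLISHED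
inputs {modularity, Kato 17.4 (1)(2)@2 at `W`, Greenberg Prop. 4.14@2}. No such `W` is known; the
`2`-adic main conjecture predicts none exists. [cite: Kato2004Asterisque, Thm. 17.4 (1)(2) (p. 273)]
[cite: GreenbergLNM1716, Prop. 4.14 (§4)] [cite: Washington1997, §13.1–13.2] -/
theorem not_ordKatoHalfAtTwo_of_towerExcess (hmod : nonempty_modularParametrizationData)
    (hcm : ¬ W.HasCM) (hr : W.analyticRank = 0) (hgo : GoodOrd W 2)
    (h17 : ∀ [NeZero (W.conductorNorm ℤ)] (f : CuspForm (Gamma0 (W.conductorNorm ℤ)) 2),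
      kato_divisibility_allPrimes W 2 (f := f))
    (h414 : prop414_noFiniteSubmodule_of_not_dvd_torsionOrder) (htors : ¬ 2 ∣ W.torsionOrder)
    {n j : ℕ} (hlan : AnalyticLambdaEq W 2 n) (hμan : AnalyticMuLE W 2 0)
    (hbig : ∀ (κ : ZpExtension ℚ 2) (γ : Field.absoluteGaloisGroup ℚ), κ.IsCyclotomic →
      κ.IsTopGenerator γ → IsCyclotomicVariable 2 γ → ∀ D : W.SelmerDualData κ γ,
      2 ^ (n + 1) ≤ Nat.card (D.X ⧸ (towerIdeal 2 j • ⊤ : Submodule (IwasawaAlgebra 2) D.X))) :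
    ¬ Summit.BirchSwinnertonDyer.BirchSwinnertonDyer.Theses.ByReductionTypeAtTwo.OrdKatoHalfAtTwo := by
  intro hK
  have hKW : MainConjectureLowerDivisibilityAtTwoOrd W := hK W hcm hr hgo
  obtain ⟨κ, hκ, γ, hγ, hγ'⟩ := exists_isCyclotomic_isTopGenerator_isCyclotomicVariable_holds 2
  obtain ⟨D⟩ := selmerDualData_nonempty_two W κ hγ
  have hlt := natCard_quotient_towerIdeal_le_pow_of_katoHalfAt W hmod h17 h414 htors hgo hKW hlan hμan
    hκ hγ hγ' D j
  exact absurd (hbig κ γ hκ hγ hγ' D) (not_le.mpr hlt)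

/-- **EXCESS TEST (layer form).** As above, with the excess read off a finite layer: at least `2^{n+1}`
two-torsion classes in `Sel_{2^∞}(W/ℚ_i)` for some layer `i` of the cyclotomic `ℤ₂`-tower (for every
cyclotomic `κ`) — with `E(ℚ_i)[2] = 0` this is `dim_{𝔽₂} Sel₂(W/ℚ_i) ≥ λ_an + 1`, a classical `2`-descent
over `ℚ_i` (tree `finite_and_natCard_selmerLayer_pTorsion_le`, seat bsd-2adic-tower-1).
[cite: GreenbergLNM1716, §1 p. 60 and §3 pp. 85–86] [cite: Kato2004Asterisque, Thm. 17.4 (1)(2) (p. 273)] -/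
theorem not_ordKatoHalfAtTwo_of_layerSelmerExcess (hmod : nonempty_modularParametrizationData)
    (hcm : ¬ W.HasCM) (hr : W.analyticRank = 0) (hgo : GoodOrd W 2)
    (h17 : ∀ [NeZero (W.conductorNorm ℤ)] (f : CuspForm (Gamma0 (W.conductorNorm ℤ)) 2),
      kato_divisibility_allPrimes W 2 (f := f))
    (h414 : prop414_noFiniteSubmodule_of_not_dvd_torsionOrder) (htors : ¬ 2 ∣ W.torsionOrder)
    {n i : ℕ} (hlan : AnalyticLambdaEq W 2 n) (hμan : AnalyticMuLE W 2 0)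
    (hsel : ∀ κ : ZpExtension ℚ 2, κ.IsCyclotomic →
      2 ^ (n + 1) ≤ Nat.card {z : W.selmerLayer κ i // 2 • z = 0}) :
    ¬ Summit.BirchSwinnertonDyer.BirchSwinnertonDyer.Theses.ByReductionTypeAtTwo.OrdKatoHalfAtTwo := by
  refine not_ordKatoHalfAtTwo_of_towerExcess W hmod hcm hr hgo h17 h414 htors (j := 2 ^ i) hlan hμan ?_
  intro κ γ hκ hγ _ D
  haveI : Module.Finite (IwasawaAlgebra 2) D.X := D.module_finite_holds hγ
  have hK := Iwasawa.forall_smul_eq_zero_imp_of_not_dvd_torsionOrder W htors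
  exact (hsel κ hκ).trans (finite_and_natCard_selmerLayer_pTorsion_le W κ D hK i).2

end Curve

end Summit.BirchSwinnertonDyer.BirchSwinnertonDyer.Theorems.KatoHalfPinch

end
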